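import Summits.Ventures.QEC.CircuitDistance.SyndromeCycle
import HarnessLib

/-!
# Word-level (bitmask) simulator of the syndrome cycle — the computable CHECKER behind `run1`

Cell `qec`, experiment CDX (engine seat qec-cdx-eng-1).  `SyndromeCycle.lean` defines the effect of a fault by propagating a
Pauli frame `Qubit → Bool × Bool` (transparent, but as nested closures it is not kernel-evaluable).  Here the same simulation
is carried out on REGISTER WORDS: for each register `r ∈ {X, L, R, Z}` two naturals `x r`, `z r` whose bit `a·m + b` is the
`x`-bit (resp. `z`-bit) of qubit `(r, (a, b))` (the tree's flat index `BB.Code.checkIndex`).  A CNOT layer `CNOT_M(a → b)` becomes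
`x_b ^^^ T_μ(x_a)`, `z_a ^^^ T_{−μ}(z_b)` with the bit translation `T_μ` (`translateW`), measurements read off whole words, and
detectors / final syndromes / logical parities are word operations — all kernel-cheap (`Nat` bit operations are
GMP-accelerated in the kernel), so explicit fault sets (`d_circ ≤ 6 / ≤ 10` witnesses) and per-column projection tables can
be certified by `decide`.  The EQUIVALENCE with `run1` (`rel_run`, and the bridges down to `hasLogicalFault_of_checks`) is proved here once; nothing in this file changes
the statement.
-/

namespace Summit.Ventures.QEC.CircuitDistance

open Literature.InformationTheory.QuantumCodes

variable {ℓ m : ℕ}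

/-! ## Words -/

/-- Flat bit index of a position: `(a, b) ↦ a·m + b` (= `BB.Code.checkIndex`). -/
def bitIdx (i : BB.Mono ℓ m) : ℕ := i.1.val * m + i.2.val

/-- The word with bits `f 0, …, f (h−1)`: `Σ_{j<h, f j} 2^j`. -/
def bitsToWord : ℕ → (ℕ → Bool) → ℕ
  | 0, _ => 0
  | h + 1, f => bitsToWord h f + (if f h then 2 ^ h else 0)

/-- `bitsToWord h f < 2^h`. -/
theorem bitsToWord_lt (h : ℕ) (f : ℕ → Bool) : bitsToWord h f < 2 ^ h := by
  induction h with
  | zero => simp [bitsToWord]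
  | succ h ih =>
    unfold bitsToWord
    split <;> · rw [Nat.pow_succ]; omega

/-- Bits of `bitsToWord`: bit `j` is `f j` for `j < h`, `false` beyond. -/
theorem testBit_bitsToWord (h : ℕ) (f : ℕ → Bool) (j : ℕ) :
    (bitsToWord h f).testBit j = (decide (j < h) && f j) := by
  induction h generalizing j with
  | zero => simp [bitsToWord]
  | succ h ih =>
    unfold bitsToWord
    have hlt := bitsToWord_lt h f
    by_cases hf : f h
    · simp only [hf, ↓reduceIte]
      rcases Nat.lt_trichotomy j h with hj | rfl | hj
      · rw [Nat.add_comm, Nat.testBit_two_pow_add_gt hj, ih]; simp [hj, Nat.lt_succ_of_lt hj]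
      · rw [Nat.add_comm, Nat.testBit_two_pow_add_eq, Nat.testBit_lt_two_pow hlt]; simp [hf]
      · have : bitsToWord h f + 2 ^ h < 2 ^ j := by
          have := Nat.pow_le_pow_right (by norm_num : 0 < 2) (Nat.succ_le_of_lt hj)
          rw [Nat.pow_succ] at this; omega
        rw [Nat.testBit_lt_two_pow this]
        have hfj : ¬ j < h + 1 := by omega
        simp [hfj]
    · simp only [hf, Bool.false_eq_true, ↓reduceIte, Nat.add_zero]
      rw [ih]
      rcases Nat.lt_trichotomy j h with hj | rfl | hj
      · simp [hj, Nat.lt_succ_of_lt hj]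
      · simp [hf]
      · have h1 : ¬ j < h := by omega
        have h2 : ¬ j < h + 1 := by omega
        simp [h1, h2]

variable [NeZero ℓ] [NeZero m]

/-- Position of a flat index (inverse of `bitIdx` on `j < ℓ·m`). -/
def monoOf (j : ℕ) : BB.Mono ℓ m := (Fin.ofNat ℓ (j / m), Fin.ofNat m (j % m))

/-- Bit translation by `μ`: bit `bitIdx (i + μ)` of `translateW μ w` is bit `bitIdx i` of `w`
(so `T_μ` moves the content of position `i` to position `i + μ`). -/
def translateW (μ : BB.Mono ℓ m) (w : ℕ) : ℕ :=
  bitsToWord (ℓ * m) fun j => w.testBit (bitIdx ((monoOf j : BB.Mono ℓ m) - μ))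

omit [NeZero ℓ] [NeZero m] in
/-- `bitIdx i < ℓ·m`. -/
theorem bitIdx_lt (i : BB.Mono ℓ m) : bitIdx i < ℓ * m := by
  unfold bitIdx
  have h1 := i.1.isLt; have h2 := i.2.isLt
  calc i.1.val * m + i.2.val < i.1.val * m + m := by omega
    _ = (i.1.val + 1) * m := by ring
    _ ≤ ℓ * m := Nat.mul_le_mul_right _ h1

/-- `monoOf` inverts `bitIdx`. -/
theorem monoOf_bitIdx (i : BB.Mono ℓ m) : (monoOf (bitIdx i) : BB.Mono ℓ m) = i := by
  have hm : 0 < m := Nat.pos_of_ne_zero (NeZero.ne m)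
  have h2 := i.2.isLt
  unfold monoOf bitIdx
  have hdiv : (i.1.val * m + i.2.val) / m = i.1.val := by
    rw [Nat.mul_comm, Nat.mul_add_div hm, Nat.div_eq_of_lt h2]; simp
  have hmod : (i.1.val * m + i.2.val) % m = i.2.val := by
    rw [Nat.mul_comm, Nat.mul_add_mod]; exact Nat.mod_eq_of_lt h2
  rw [hdiv, hmod]
  ext <;> simp [Fin.ofNat, Nat.mod_eq_of_lt i.1.isLt, Nat.mod_eq_of_lt i.2.isLt]

omit [NeZero ℓ] in
/-- `bitIdx` is injective. -/
theorem bitIdx_injective : Function.Injective (bitIdx : BB.Mono ℓ m → ℕ) := by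
  intro i j hij
  haveI : NeZero ℓ := ⟨by intro h; subst h; exact absurd i.1.isLt (by simp)⟩
  have := congrArg (fun n => (monoOf n : BB.Mono ℓ m)) hij
  simpa [monoOf_bitIdx] using this

/-- THE BIT LEMMA of the translation: bit `bitIdx i` of `T_μ w` is bit `bitIdx (i − μ)` of `w`. -/
theorem testBit_translateW (μ : BB.Mono ℓ m) (w : ℕ) (i : BB.Mono ℓ m) :
    (translateW μ w).testBit (bitIdx i) = w.testBit (bitIdx (i - μ)) := by
  unfold translateW
  rw [testBit_bitsToWord]
  simp [bitIdx_lt, monoOf_bitIdx]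

/-- Equivalently: `T_μ` moves bit `bitIdx i` to bit `bitIdx (i + μ)`. -/
theorem testBit_translateW_add (μ : BB.Mono ℓ m) (w : ℕ) (i : BB.Mono ℓ m) :
    (translateW μ w).testBit (bitIdx (i + μ)) = w.testBit (bitIdx i) := by
  rw [testBit_translateW, add_sub_cancel_right]

omit [NeZero ℓ] in
/-- Bits of the one-hot word `2^{bitIdx i}`. -/
theorem testBit_two_pow_bitIdx (i j : BB.Mono ℓ m) :
    (2 ^ bitIdx i).testBit (bitIdx j) = decide (j = i) := by
  rw [Nat.testBit_two_pow]
  by_cases h : j = i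
  · subst h; simp
  · have : bitIdx i ≠ bitIdx j := fun e => h (bitIdx_injective e).symm
    simp [this, h]

/-! ## Word states and the simulation -/

/-- Register words: `x`-bits and `z`-bits of the four registers, and the recorded outcome-flip words per cycle
(`mX c`, `mZ c` as functions of the cycle number, all-zero outside `1 … Nc`). -/
structure WState where
  /-- `x`-bits of register `q(X)` -/ xX : ℕ
  /-- `x`-bits of `q(L)` -/ xL : ℕ
  /-- `x`-bits of `q(R)` -/ xR : ℕ
  /-- `x`-bits of `q(Z)` -/ xZ : ℕ
  /-- `z`-bits of `q(X)` -/ zX : ℕ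
  /-- `z`-bits of `q(L)` -/ zL : ℕ
  /-- `z`-bits of `q(R)` -/ zR : ℕ
  /-- `z`-bits of `q(Z)` -/ zZ : ℕ
  /-- `X`-check outcome flips by cycle -/ mX : ℕ → ℕ
  /-- `Z`-check outcome flips by cycle -/ mZ : ℕ → ℕ

namespace WState

/-- All-clear word state. -/
def init : WState := ⟨0, 0, 0, 0, 0, 0, 0, 0, fun _ => 0, fun _ => 0⟩

/-- `x`-word of a register. -/
def x (s : WState) : Reg → ℕ
  | .X => s.xX | .L => s.xL | .R => s.xR | .Z => s.xZ

/-- `z`-word of a register. -/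
def z (s : WState) : Reg → ℕ
  | .X => s.zX | .L => s.zL | .R => s.zR | .Z => s.zZ

/-- Replace the `x`-word of a register. -/
def setX (s : WState) : Reg → ℕ → WState
  | .X, w => { s with xX := w } | .L, w => { s with xL := w } | .R, w => { s with xR := w } | .Z, w => { s with xZ := w }

/-- Replace the `z`-word of a register. -/
def setZ (s : WState) : Reg → ℕ → WState
  | .X, w => { s with zX := w } | .L, w => { s with zL := w } | .R, w => { s with zR := w } | .Z, w => { s with zZ := w }

end WState

/-- Word-level action of an event (mirror of `applyEv`). -/
def applyEvW (S : SMCode ℓ m) : Ev → WState → WState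
  | .cnot _ lay, s =>
      let a := lay.ctrl; let b := lay.tgt; let μ := lay.mon S
      let s1 := s.setX b (s.x b ^^^ translateW μ (s.x a))
      s1.setZ a (s1.z a ^^^ translateW (-μ) (s1.z b))
  | .measX c, s => { s with mX := fun c' => if c' = c then s.mX c' ^^^ s.zX else s.mX c' }
  | .measZ c, s => { s with mZ := fun c' => if c' = c then s.mZ c' ^^^ s.xZ else s.mZ c' }
  | .initX _, s => { s with xX := 0, zX := 0 }
  | .initZ _, s => { s with xZ := 0, zZ := 0 }
  | .idle _ _, s => s

/-- XOR a single-qubit Pauli `p` into the words at `(r, i)`. -/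
def WState.mulAt (s : WState) (r : Reg) (i : BB.Mono ℓ m) (p : P1) : WState :=
  let s1 := if p.1 then s.setX r (s.x r ^^^ 2 ^ bitIdx i) else s
  if p.2 then s1.setZ r (s1.z r ^^^ 2 ^ bitIdx i) else s1

/-- Word-level fault injection (mirror of `inject`). -/
def injectW (S : SMCode ℓ m) : Fault ℓ m → WState → WState
  | .cnot _ lay i pc pt, s => (s.mulAt lay.ctrl i pc).mulAt lay.tgt (i + lay.mon S) pt
  | .idle _ sl i p, s => s.mulAt sl.reg i p
  | .initX _ i, s => s.mulAt .X i (false, true)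
  | .initZ _ i, s => s.mulAt .Z i (true, false)
  | .measX c i, s => { s with mX := fun c' => if c' = c then s.mX c' ^^^ 2 ^ bitIdx i else s.mX c' }
  | .measZ c i, s => { s with mZ := fun c' => if c' = c then s.mZ c' ^^^ 2 ^ bitIdx i else s.mZ c' }

/-- Word-level simulation with the pending fault `f` (mirror of `simulate`). -/
def simulateW (S : SMCode ℓ m) (f : Fault ℓ m) : List Ev → WState → WState
  | [], s => s
  | e :: es, s =>
      let s' := applyEvW S e s
      simulateW S f es (if e = f.ev then injectW S f s' else s')

/-- Word-level final state of a single fault (mirror of `run1`). -/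
def runW (S : SMCode ℓ m) (Nc : ℕ) (f : Fault ℓ m) : WState := simulateW S f (allEvents Nc) WState.init

/-! ## Syndromes, detectors and logical parities on words -/

/-- `X`-check syndrome word of a data `Z`-error given as words `(zL, zR)`: bit `i` = parity of the error on the support
`{L[i + a_p], R[i + b_p]}` of `X`-check `i`, i.e. `⊕_p T_{−a_p} zL ⊕ ⊕_p T_{−b_p} zR`. -/
def synXW (S : SMCode ℓ m) (zL zR : ℕ) : ℕ :=
  translateW (-S.amon 0) zL ^^^ translateW (-S.amon 1) zL ^^^ translateW (-S.amon 2) zL ^^^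
    translateW (-S.bmon 0) zR ^^^ translateW (-S.bmon 1) zR ^^^ translateW (-S.bmon 2) zR

/-- `Z`-check syndrome word of a data `X`-error `(xL, xR)`: `Z`-check `i` has support `{L[i − b_p], R[i − a_p]}`. -/
def synZW (S : SMCode ℓ m) (xL xR : ℕ) : ℕ :=
  translateW (S.bmon 0) xL ^^^ translateW (S.bmon 1) xL ^^^ translateW (S.bmon 2) xL ^^^
    translateW (S.amon 0) xR ^^^ translateW (S.amon 1) xR ^^^ translateW (S.amon 2) xR

/-- Word-level EFFECT of faults: outcome-flip words per cycle and residual data-error words. -/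
structure WEffect where
  /-- `X`-check outcome flips by cycle -/ mX : ℕ → ℕ
  /-- `Z`-check outcome flips by cycle -/ mZ : ℕ → ℕ
  /-- residual `x`-bits on `q(L)` -/ xL : ℕ
  /-- residual `x`-bits on `q(R)` -/ xR : ℕ
  /-- residual `z`-bits on `q(L)` -/ zL : ℕ
  /-- residual `z`-bits on `q(R)` -/ zR : ℕ

/-- The effect carried by a final word state. -/
def WState.effect (s : WState) : WEffect := ⟨s.mX, s.mZ, s.xL, s.xR, s.zL, s.zR⟩

/-- `𝔽₂`-sum of effects. -/
def WEffect.add (a b : WEffect) : WEffect :=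
  ⟨fun c => a.mX c ^^^ b.mX c, fun c => a.mZ c ^^^ b.mZ c, a.xL ^^^ b.xL, a.xR ^^^ b.xR, a.zL ^^^ b.zL, a.zR ^^^ b.zR⟩

/-- Zero effect. -/
def WEffect.zero : WEffect := ⟨fun _ => 0, fun _ => 0, 0, 0, 0, 0⟩

/-- Total word-level effect of a LIST of faults. -/
def effectWs (S : SMCode ℓ m) (Nc : ℕ) (F : List (Fault ℓ m)) : WEffect :=
  F.foldr (fun f acc => (runW S Nc f).effect.add acc) WEffect.zero

/-- `X`-detector word of layer `t` (`1 ≤ t ≤ Nc+1`) of an effect: measured-syndrome change, final layer against the TRUE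
residual syndrome `synXW`. `0` for other `t`. -/
def WEffect.detX (S : SMCode ℓ m) (Nc : ℕ) (E : WEffect) (t : ℕ) : ℕ :=
  if t = 0 then 0
  else if t ≤ Nc then E.mX t ^^^ E.mX (t - 1)
  else if t = Nc + 1 then synXW S E.zL E.zR ^^^ E.mX Nc
  else 0

/-- `Z`-detector word of layer `t`. -/
def WEffect.detZ (S : SMCode ℓ m) (Nc : ℕ) (E : WEffect) (t : ℕ) : ℕ :=
  if t = 0 then 0
  else if t ≤ Nc then E.mZ t ^^^ E.mZ (t - 1)
  else if t = Nc + 1 then synZW S E.xL E.xR ^^^ E.mZ Nc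
  else 0

/-- Word-level UNDETECTABILITY check of a fault list: every fault sits on an event of the circuit and every detector word of
layers `1 … Nc+1` vanishes (cycle-`0` flips vanish too, which holds automatically for faults of the circuit). -/
def undetectableW (S : SMCode ℓ m) (Nc : ℕ) (F : List (Fault ℓ m)) : Bool :=
  F.all (fun f => (allEvents Nc).contains f.ev) &&
    (List.range (Nc + 2)).all (fun t => (effectWs S Nc F).detX S Nc t == 0 && (effectWs S Nc F).detZ S Nc t == 0) &&
    ((effectWs S Nc F).mX 0 == 0) && ((effectWs S Nc F).mZ 0 == 0)

/-- Parity of the low `h` bits of a word. -/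
def wordParity : ℕ → ℕ → Bool
  | 0, _ => false
  | h + 1, w => xor (w.testBit h) (wordParity h w)

/-- Parity of the overlap of two data vectors given as word pairs `(L-word, R-word)` of `h`-bit words. -/
def oddOverlap (h : ℕ) (aL aR bL bR : ℕ) : Bool :=
  xor (wordParity h (aL &&& bL)) (wordParity h (aR &&& bR))

/-- Word-level LOGICAL-ERROR check with an explicit witness: either a `Z`-type vector `u = (uL, uR)` with `H^X u = 0` and odd
overlap with the residual `X`-error (so the `X`-error is not a product of `X`-checks), or an `X`-type vector with `H^Z u = 0`
and odd overlap with the residual `Z`-error. -/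
def logicalErrorW (S : SMCode ℓ m) (Nc : ℕ) (F : List (Fault ℓ m)) (sector : Bool) (uL uR : ℕ) : Bool :=
  let E := effectWs S Nc F
  if sector then synXW S uL uR == 0 && oddOverlap (ℓ * m) uL uR E.xL E.xR      -- X-type residual error vs Z-type witness u
  else synZW S uL uR == 0 && oddOverlap (ℓ * m) uL uR E.zL E.zR                  -- Z-type residual error vs X-type witness u

/-! ## Flat-index sums and word-encoded vectors (used by the soundness file) -/

/-- `bitIdx` of `monoOf j` is `j` for `j < ℓ·m`. -/
theorem bitIdx_monoOf {j : ℕ} (hj : j < ℓ * m) : bitIdx (monoOf j : BB.Mono ℓ m) = j := by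
  have hm : 0 < m := Nat.pos_of_ne_zero (NeZero.ne m)
  have hdiv : j / m < ℓ := by
    rw [Nat.div_lt_iff_lt_mul hm]; exact hj
  unfold bitIdx monoOf
  simp only [Fin.ofNat, Nat.mod_eq_of_lt hdiv, Nat.mod_eq_of_lt (Nat.mod_lt j hm)]
  exact Nat.div_add_mod' j m

/-- The flat-index equivalence `Mono ℓ m ≃ Fin (ℓ·m)` given by `bitIdx`. -/
def bitIdxEquiv : BB.Mono ℓ m ≃ Fin (ℓ * m) where
  toFun i := ⟨bitIdx i, bitIdx_lt i⟩
  invFun j := monoOf j.val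
  left_inv i := monoOf_bitIdx i
  right_inv j := Fin.ext (bitIdx_monoOf j.isLt)

/-- Sums over positions are sums over flat indices `0 … ℓm−1`. -/
theorem sum_mono_eq_sum_range {M : Type*} [AddCommMonoid M] (g : ℕ → M) :
    ∑ i : BB.Mono ℓ m, g (bitIdx i) = ∑ j ∈ Finset.range (ℓ * m), g j := by
  rw [← Fin.sum_univ_eq_sum_range]
  exact Fintype.sum_equiv bitIdxEquiv _ _ (fun i => rfl)

omit [NeZero ℓ] [NeZero m] in
/-- Sum of two indicators in `𝔽₂`. -/
theorem ite_add_ite (a b : Bool) :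
    ((if a then (1 : ZMod 2) else 0) + (if b then 1 else 0)) = if (b ^^ a) then 1 else 0 := by
  cases a <;> cases b <;> decide

omit [NeZero ℓ] [NeZero m] in
/-- Indicator sums in `𝔽₂` over the low `h` bits equal the indicator of `wordParity`. -/
theorem sum_range_ite_testBit (h v : ℕ) :
    ∑ j ∈ Finset.range h, (if v.testBit j then (1 : ZMod 2) else 0) = if wordParity h v then 1 else 0 := by
  induction h with
  | zero => simp [wordParity]
  | succ h ih =>
    rw [Finset.sum_range_succ, ih, ite_add_ite]
    rfl

/-- The data vector (over `Mono ⊕ Mono`) encoded by a pair of words. -/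
def vecOfWords (uL uR : ℕ) : BB.Mono ℓ m ⊕ BB.Mono ℓ m → ZMod 2 :=
  Sum.elim (fun i => if uL.testBit (bitIdx i) then 1 else 0) (fun i => if uR.testBit (bitIdx i) then 1 else 0)

omit [NeZero ℓ] [NeZero m] in
/-- Product of two indicators. -/
theorem ite_mul_ite (a b : Bool) :
    ((if a then (1 : ZMod 2) else 0) * (if b then 1 else 0)) = if (a && b) then 1 else 0 := by
  cases a <;> cases b <;> simp


end Summit.Ventures.QEC.CircuitDistance
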